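import Summits.Langlands.Langlands.Theorems.AbelianSurfaceSerreSerreGSp4SurjectiveSingerDefs

/-!
# Strategy census — crux `SerreGSp4Surjective` (stmt-Langlands-17765): typed appendix

Strategist seat `planner-cstrat-stmt-Langlands-17765-s2-0` (crux-strategist, gen 1, 2026-08-17).
Companion of `STRATEGY-CENSUS.md` (same crux directory).  NOTHING here is a registered skeleton and
nothing is asserted: every `def … : Prop` is a *statement* used to make the census entries precise,
and the theorems are (i) the trivial compositions showing what each lens would still owe, (ii) the
negation shape of the crux, (iii) two arithmetic facts behind obstruction note SN1.

* §1 STRENGTHEN — `SPlus` (Serre for `GSp₄/ℚ`, coefficient-, shape-, level- and image-blind: the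
  only form closed under a Khare–Wintenberger induction) and `crux_of_sPlus` : the crux follows from
  `SPlus` + `FullImageBridge` (folklore algebra) + `WeightPartEndgame` (weight part of Serre + Hida
  theory, Gee–Geraghty 2012 / Herzig–Tilouine 2013).  `SPlus` is HARDER than the crux; see the .md
  for why the added rigidity buys nothing (no any-weight void for `GSp₄` at 2, 3; missing engines).
* §2 DECOMPOSITION (the "solvable switch", wall W3′) — `SolvablePotentialResidualAutomorphy`,
  `SolvableDescent` (Barnet-Lamb–Geraghty–Harris–Taylor, Lemma 1.4: in print) as signatures.
* §3 NEGATION — `CounterexampleShape` and `not_crux_iff`.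
* §4 SN1 — `prime_dvd_card_GSp4_F3`, `prime_dvd_card_GSp4_F2`: the only primes dividing
  `|GSp₄(𝔽₃)| = 103680` resp. `|GSp₄(𝔽₂)| = 720` are `2, 3, 5`; hence an inertial scar of prime order
  `p ≥ 7` (Khare–Larsen–Savin / Coxeter device of the live line) forbids `𝔽₃`- and `𝔽₂`-rational
  residues, i.e. excludes BCGP's two motivic anchors for every such family.
-/

set_option linter.dupNamespace false

namespace Summit.Langlands.Langlands.Cruxes.SerreGSp4Surjective.Strategist

open Literature.NumberTheory.GaloisRepresentations Literature.NumberTheory.Automorphic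
open Summit.Langlands.Langlands.Cruxes.SerreGSp4Surjective.SingerTypeEvaporation
open scoped NumberField
open IsDedekindDomain Polynomial

noncomputable section

/-! ## §0 Vocabulary over a general number field `K` -/

/-- **Automorphy of `r : Γ_K → GL₄(ℚ̄_p)` over the number field `K`** (a.e. form, Harris–Lan–
Taylor–Thorne normalisation `m = 4`): verbatim `AutomorphicAE` with `ℚ` replaced by `K`. [folklore] -/
def AutomorphicOver (K : Type) [Field K] [NumberField K] (p : ℕ) [Fact p.Prime]
    (r : FramedGaloisRep K (PadicAlgCl p) 4) : Prop :=
  ∃ (hcpt : isCompact_glFiniteIntegralLevel 4 K) (π : CuspidalAutomorphicRepData 4 K hcpt)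
    (ι : PadicAlgCl p ≃+* ℂ),
    π.1.IsRegularAlgebraic ∧
      ∀ᶠ v : HeightOneSpectrum (𝓞 K) in Filter.cofinite, ∃ a : Multiset ℂ,
        π.1.HasSatakeParamAt v a ∧ r.IsUnramifiedAt v ∧
          r.HasFrobCharpolyAt v (arithFrobPolyOfSatake ι v.residueCard 4 a)

/-- **Residual automorphy of `ρ' : Γ_K → GL₄(k)` at `p` over `K`, ANY level, ANY regular weight**:
some regular algebraic cuspidal `π` on `GL₄(𝔸_K)`, `ι`, and a `p`-adic `r₁` automorphic via `(π, ι)`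
whose integral characteristic polynomials reduce to those of `ρ' ⊗ k̄` along some `red` (the crux's
reduction device, verbatim, over `K`).  No condition at `p` on `π` or `r₁` (contrast
`SingerTypeEvaporation.ResiduallyAutomorphic`, which asks `π` unramified at `ℓ` and `r₁`
Fontaine–Laffaille). [folklore] -/
def ResiduallyAutomorphicOver (K : Type) [Field K] [NumberField K] (p : ℕ) [Fact p.Prime]
    {k : Type} [Field k] [TopologicalSpace k] (ρ' : FramedGaloisRep K k 4) : Prop :=
  ∃ (hcpt : isCompact_glFiniteIntegralLevel 4 K) (π : CuspidalAutomorphicRepData 4 K hcpt)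
    (ι : PadicAlgCl p ≃+* ℂ) (r₁ : FramedGaloisRep K (PadicAlgCl p) 4),
    π.1.IsRegularAlgebraic ∧
    (∀ᶠ v : HeightOneSpectrum (𝓞 K) in Filter.cofinite, ∃ a : Multiset ℂ,
      π.1.HasSatakeParamAt v a ∧ r₁.IsUnramifiedAt v ∧
        r₁.HasFrobCharpolyAt v (arithFrobPolyOfSatake ι v.residueCard 4 a)) ∧
    ∃ red : (Valued.v : Valuation (PadicAlgCl p) NNReal).valuationSubring →+* AlgebraicClosure k,
      ∀ g : Field.absoluteGaloisGroup K,
        ∃ P : Polynomial (Valued.v : Valuation (PadicAlgCl p) NNReal).valuationSubring,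
          P.map (Valued.v : Valuation (PadicAlgCl p) NNReal).valuationSubring.subtype =
              FramedRep.charpoly r₁ g ∧
            P.map red = (FramedRep.charpoly ρ' g).map (algebraMap k (AlgebraicClosure k))

/-- `ρ' : Γ_ℚ → GL₄(k)` (`k` of characteristic `p`) is symplectic with multiplier EXACTLY `ε̄_p⁻¹`
(pushed into `k` along `𝔽_p → k`). [folklore] -/
def SymplecticInvCyc (p : ℕ) [Fact p.Prime] {k : Type} [Field k] [CharP k p] [TopologicalSpace k]
    (ρ' : FramedGaloisRep ℚ k 4) : Prop :=
  ρ'.IsSymplecticWithMultiplierFun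
    (fun g => ZMod.castHom (dvd_refl p) k (((modPCyclotomicCharacterZMod ℚ p g)⁻¹ : (ZMod p)ˣ) : ZMod p))

/-- `ρ' ⊗ k̄` is irreducible (absolute irreducibility). [folklore] -/
def AbsIrreducible {k : Type} [Field k] [TopologicalSpace k] (ρ' : FramedGaloisRep ℚ k 4) : Prop :=
  Representation.IsIrreducible
    (FramedRep.baseChangeRepresentation (algebraMap k (AlgebraicClosure k)) ρ')

/-! ## §1 STRENGTHEN — the inductive closure `S⁺` and what it still owes -/

/-- **`S⁺` — Serre's conjecture for `GSp₄/ℚ`, weak form, in the generality a Khare–Wintenberger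
induction would have to carry as its induction hypothesis**: for EVERY prime `p ≥ 5`, EVERY finite
coefficient field `k` of characteristic `p` (BN1: chains do not control residue fields), EVERY
absolutely irreducible `ρ̄ : Γ_ℚ → GL₄(k)` symplectic with multiplier `ε̄⁻¹` (odd), with NO
condition at `p` (BN2: shapes at later primes are not steerable) and NO image condition, `ρ̄` is
residually automorphic from a regular algebraic cuspidal `π` on `GL₄/ℚ` of SOME level and weight.
Strictly stronger than the crux in four independent directions (coefficients, shape, image,
uniformity from `p = 5`). [cite: HerzigTilouine2013, Conj. 1] -/
def SPlus : Prop :=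
  ∀ (p : ℕ) [Fact p.Prime], 5 ≤ p →
    ∀ (k : Type) [Field k] [Fintype k] [CharP k p] [TopologicalSpace k] [DiscreteTopology k]
      (ρ' : FramedGaloisRep ℚ k 4),
      SymplecticInvCyc p ρ' → AbsIrreducible ρ' → ResiduallyAutomorphicOver ℚ p ρ'

/-- Folklore bridge from the crux's (H1) to the hypotheses of `S⁺` at `k = 𝔽_p`: full image
`GSp(J)(𝔽_p)` ⇒ symplectic-`ε̄⁻¹` (immediate) and absolutely irreducible (`Sp₄(𝔽_p)` is
transitive on non-zero vectors, Witt).  Size S/M; not the issue. [folklore] -/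
def FullImageBridge : Prop :=
  ∀ (p : ℕ) [Fact p.Prime] (ρ : FramedGaloisRep ℚ (ZMod p) 4),
    FullSymplecticImage p ρ → SymplecticInvCyc p ρ ∧ AbsIrreducible ρ

/-- **Weight part of Serre + Hida theory for `GSp₄/ℚ`** (what `S⁺` still owes the crux): for
`p ≥ p₅`, a full-image, ordinary `p`-distinguished `ρ̄` that is residually automorphic of SOME
level and weight is ORDINARILY automorphic of regular weight and level prime to `p` with a
crystalline-ordinary `r` of strictly increasing shape — the crux's conclusion verbatim.  In print
for the generic (`μ̄_i μ̄_j⁻¹ ≠ ε̄`) residues: Gee–Geraghty 2012 Thm 7.5.2 with Lemma 7.6.7,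
BLGGT 2014 Thm 2.4.1, Caraiani 2014; the weight part proper (automorphic of some Serre weight ⇒
of the predicted ordinary weight) is Herzig–Tilouine 2013 Conj. 1, a theorem only in the tame
generic case (Lee, arXiv:2304.13879 Thm 1.5.6, over `F` with `p` unramified).  Same content as the
live line's `stub_ordinaryEndgame`; size XL. [cite: arXiv:1001.2044, Thm 7.5.2] -/
def WeightPartEndgame : Prop :=
  ∃ p₅ : ℕ, ∀ (p : ℕ) [Fact p.Prime], p₅ ≤ p → ∀ ρ : FramedGaloisRep ℚ (ZMod p) 4,
    FullSymplecticImage p ρ → OrdinaryDistinguishedAt p ρ →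
      ResiduallyAutomorphicOver ℚ p ρ → RegularOrdinaryModular p ρ

/-- **STRENGTHEN lens, typed**: the crux from `S⁺`, the folklore bridge and the weight-part
endgame (`p₀ = max 5 p₅`).  Pure logic. [folklore] -/
theorem crux_of_sPlus (hS : SPlus) (hB : FullImageBridge) (hW : WeightPartEndgame) :
    Summit.Langlands.Langlands.Theses.AbelianSurfaceSerre.SerreGSp4Surjective := by
  obtain ⟨p₅, hW⟩ := hW
  refine serreGSp4Surjective_iff.mpr ⟨max 5 p₅, fun p _ hp ρ h1 h2 => ?_⟩
  have h5 : 5 ≤ p := (le_max_left _ _).trans hp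
  have hp₅ : p₅ ≤ p := (le_max_right _ _).trans hp
  obtain ⟨hsymp, hirr⟩ := hB p ρ h1
  exact hW p hp₅ ρ h1 h2 (hS p h5 (ZMod p) ρ hsymp hirr)

/-! ## §2 DECOMPOSITION — the solvable switch (wall W3′), as signatures -/

/-- **Solvable potential residual automorphy** (the Diophantine half of W3′): for `p ≥ p₀` and every
`ρ̄` of the crux's domain there is a finite SOLVABLE Galois TOTALLY REAL `F/ℚ` over which `ρ̄|Γ_F`
is residually automorphic (regular algebraic cuspidal `π` on `GL₄(𝔸_F)`, any level and weight).
Moret-Bailly/Taylor/BCGP 2021 give this WITHOUT "solvable" (the field of totally real algebraic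
numbers is PRC); with it, it is the arithmetic of twisted level-`p` Siegel moduli threefolds over
`ℚ^{tr,solv}` — of general type for `p ≥ 5` (Yamazaki 1976) — and contains the open problem
"is `ℚ_solv` PAC?" (Fried–Jarden, Field Arithmetic, Problem 11.5.9(a)) in its totally-real-with-
local-conditions form.  Crux ⇒ this with `F = ℚ`; this ⇒ crux via `SolvableDescent` + lifting +
`WeightPartEndgame`: a COSTUME of the crux unless the Diophantine statement acquires a tool.
[cite: arXiv:1812.09269, Thm 9.x (potential modularity)] -/
def SolvablePotentialResidualAutomorphy : Prop :=
  ∃ p₀ : ℕ, ∀ (p : ℕ) [Fact p.Prime], p₀ ≤ p → ∀ ρ : FramedGaloisRep ℚ (ZMod p) 4,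
    FullSymplecticImage p ρ → OrdinaryDistinguishedAt p ρ →
      ∃ (F : Type) (_ : Field F) (_ : NumberField F) (_ : IsGalois ℚ F),
        IsSolvable (F ≃ₐ[ℚ] F) ∧ NumberField.IsTotallyReal F ∧
          ResiduallyAutomorphicOver F p (ρ.restrictField F)

/-- **Solvable descent of automorphy** (the in-print half of W3′; Barnet-Lamb–Geraghty–Harris–
Taylor, *A family of Calabi–Yau varieties and potential automorphy II*, Lemma 1.4, by induction on
cyclic layers from Arthur–Clozel): if `F/ℚ` is finite solvable Galois totally real and the
restriction of the `p`-adic `r` to `Γ_F` is irreducible and automorphic over `F`, then `r` is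
automorphic over `ℚ`.  (As typed the regularity/self-duality side conditions of the printed lemma
ride inside `AutomorphicOver`/`AutomorphicAE`: regular algebraic; essential self-duality is
automatic for the symplectic `r` of this crux and would be added as a hypothesis by a prover.)
[cite: BarnetlambEtAl2014, §4 (use of BLGHT Lemma 1.4)] -/
def SolvableDescent : Prop :=
  ∀ (p : ℕ) [Fact p.Prime] (F : Type) [Field F] [NumberField F] [IsGalois ℚ F],
    IsSolvable (F ≃ₐ[ℚ] F) → NumberField.IsTotallyReal F →
      ∀ r : FramedGaloisRep ℚ (PadicAlgCl p) 4,
        FramedRep.IsIrreducible (r.restrictField F) →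
          AutomorphicOver F p (r.restrictField F) → AutomorphicAE p r

/-! ## §3 NEGATION — the shape of a counterexample -/

/-- A counterexample to the crux: for every threshold `p₀` a prime `p ≥ p₀` and a full-image,
ordinary `p`-distinguished `ρ̄` mod `p` with NO regular-ordinary automorphic lift of level prime
to `p` in the crux's normalisation. [folklore] -/
def CounterexampleShape : Prop :=
  ∀ p₀ : ℕ, ∃ (p : ℕ) (_ : Fact p.Prime), p₀ ≤ p ∧ ∃ ρ : FramedGaloisRep ℚ (ZMod p) 4,
    FullSymplecticImage p ρ ∧ OrdinaryDistinguishedAt p ρ ∧ ¬ RegularOrdinaryModular p ρ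

/-- The negation of the crux is exactly `CounterexampleShape` (bookkeeping for the Negation lens;
`Disproof.lean` §1 shows no `ρ̄` passing (H1) is constructible in the tree, so no instance of the
right-hand side is typable today). [folklore] -/
theorem not_crux_iff :
    ¬ Summit.Langlands.Langlands.Theses.AbelianSurfaceSerre.SerreGSp4Surjective ↔
      CounterexampleShape := by
  rw [serreGSp4Surjective_iff, CounterexampleShape]
  constructor
  · intro h p₀
    by_contra hc
    push Not at hc
    exact h ⟨p₀, fun p hp hle ρ h1 h2 => hc p hp hle ρ h1 h2⟩
  · rintro h ⟨p₀, hp₀⟩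
    obtain ⟨p, hp, hle, ρ, h1, h2, h3⟩ := h p₀
    exact h3 (hp₀ p hle ρ h1 h2)

/-! ## §4 SN1 — scars of prime order `p ≥ 7` forbid `𝔽₃`- and `𝔽₂`-rational residues -/

/-- `|GSp₄(𝔽₃)| = 2 · |Sp₄(𝔽₃)| = 2 · 3⁴ (3² - 1)(3⁴ - 1) = 103680 = 2⁸ · 3⁴ · 5`. [folklore] -/
theorem card_GSp4_F3_eq : 2 * (3 ^ 4 * (3 ^ 2 - 1) * (3 ^ 4 - 1)) = 2 ^ 8 * 3 ^ 4 * 5 := by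
  norm_num

/-- `|GSp₄(𝔽₂)| = |Sp₄(𝔽₂)| = 2⁴ (2² - 1)(2⁴ - 1) = 720 = 2⁴ · 3² · 5`. [folklore] -/
theorem card_GSp4_F2_eq : 2 ^ 4 * (2 ^ 2 - 1) * (2 ^ 4 - 1) = 2 ^ 4 * 3 ^ 2 * 5 := by
  norm_num

/-- A prime dividing `|GSp₄(𝔽₃)| = 2⁸ · 3⁴ · 5` is `2`, `3` or `5`.  Consequence (SN1): a mod-`3`
representation whose image contains an element of prime order `p ≥ 7` — e.g. the residue at `3`
of any member of a family carrying a Khare–Larsen–Savin scar of order `p` — is NOT conjugate into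
`GSp₄(𝔽₃)`; BCGP's `A[3]` anchor (which needs `𝔽₃`-coefficients, BN1) is excluded for it.
[folklore] -/
theorem prime_dvd_card_GSp4_F3 {p : ℕ} (hp : p.Prime) (h : p ∣ 2 ^ 8 * 3 ^ 4 * 5) :
    p = 2 ∨ p = 3 ∨ p = 5 := by
  rcases (Nat.Prime.dvd_mul hp).mp h with h | h
  · rcases (Nat.Prime.dvd_mul hp).mp h with h | h
    · exact Or.inl ((Nat.prime_dvd_prime_iff_eq hp Nat.prime_two).mp (hp.dvd_of_dvd_pow h))
    · exact Or.inr (Or.inl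
        ((Nat.prime_dvd_prime_iff_eq hp Nat.prime_three).mp (hp.dvd_of_dvd_pow h)))
  · exact Or.inr (Or.inr ((Nat.prime_dvd_prime_iff_eq hp Nat.prime_five).mp h))

/-- A prime dividing `|GSp₄(𝔽₂)| = 2⁴ · 3² · 5` is `2`, `3` or `5` (SN1 at the anchor `2`). [folklore] -/
theorem prime_dvd_card_GSp4_F2 {p : ℕ} (hp : p.Prime) (h : p ∣ 2 ^ 4 * 3 ^ 2 * 5) :
    p = 2 ∨ p = 3 ∨ p = 5 := by
  rcases (Nat.Prime.dvd_mul hp).mp h with h | h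
  · rcases (Nat.Prime.dvd_mul hp).mp h with h | h
    · exact Or.inl ((Nat.prime_dvd_prime_iff_eq hp Nat.prime_two).mp (hp.dvd_of_dvd_pow h))
    · exact Or.inr (Or.inl
        ((Nat.prime_dvd_prime_iff_eq hp Nat.prime_three).mp (hp.dvd_of_dvd_pow h)))
  · exact Or.inr (Or.inr ((Nat.prime_dvd_prime_iff_eq hp Nat.prime_five).mp h))

/-- The general SN1 criterion at a small anchor prime `ℓ` for coefficients `𝔽_{ℓ^f}`:
`|GSp₄(𝔽_q)| = (q-1) q⁴ (q²-1)(q⁴-1)` with `q = ℓ^f`, and `q - 1 ∣ q⁴ - 1`, `q² - 1 ∣ q⁴ - 1`; so a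
prime `p ∤ ℓ` divides the order iff `p ∣ q⁴ - 1`, i.e. iff `ord_p(ℓ) ∣ 4f`.  Checked instance: at
`ℓ = 3`, `f = 1`, `q⁴ - 1 = 80`, whose prime divisors are `2, 5` only. [folklore] -/
theorem prime_dvd_three_pow_four_sub_one {p : ℕ} (hp : p.Prime) (h : p ∣ 3 ^ 4 - 1) :
    p = 2 ∨ p = 5 := by
  have h80 : (3 : ℕ) ^ 4 - 1 = 2 ^ 4 * 5 := by norm_num
  rw [h80] at h
  rcases (Nat.Prime.dvd_mul hp).mp h with h | h
  · exact Or.inl ((Nat.prime_dvd_prime_iff_eq hp Nat.prime_two).mp (hp.dvd_of_dvd_pow h))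
  · exact Or.inr ((Nat.prime_dvd_prime_iff_eq hp Nat.prime_five).mp h)

end

end Summit.Langlands.Langlands.Cruxes.SerreGSp4Surjective.Strategist
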